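import Summits.RiemannHypothesis.RiemannHypothesis.Theorems.SpectralTraceWindowStepStubGapLemma
import HarnessLib

/-!
# Coagulation excluded for sub-logarithmic multiplicities (line `conjugate-point`, RH-free)

Route `RiemannHypothesis/SpectralTrace`, crux `WindowStep` (stmt-RiemannHypothesis-14659), line
`conjugate-point`, in support of the registered stub `stub_coagulationExcluded` (the edge horn of the
dichotomy: at a conjugate point no level-`2a` rung family of unbounded multiplicity lies in the real
zero set of a ground-state transform `û`). That stub is RH-implied and open as registered; this file
proves its SMALL-MULTIPLICITY SUB-CASES, which need neither `ε(a) = 0` nor `a ≥ log 3 / 2`: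

* `exists_card_real_zeros_le_slope` — the linear Jensen count of the real zeros of `û(1/2 + i·)`
  with the explicit slope `2a / log 2` (from `card_real_zeros_weilMellin_le` of the `stub_gapLemma`
  file);
* `coagulation_excluded_of_mult_le_log` — **uniform threshold.** For every `a > 0` there is
  `δ = δ(a) > 0` such that: if a real family `γ : ι → ℝ` reproduces the Weil functional on the Weil
  tests of `[-2a, 2a]` and its multiplicities satisfy `#{i | γ i = x} ≤ δ log |x|` for `|x|` large,
  then `û(1/2 + iγ_i) ≠ 0` for some `i`, for every ground state `u` of the window `[-a, a]`;
* `coagulation_excluded_of_ncard_isLittleO` — in particular if `#{i | γ i = x} = o(log |x|)`;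
* `coagulation_excluded_of_isLittleO` — the same with the fibres bounded by finsets of size `≤ m(x)`,
  `m = o(log)`;
* `coagulation_excluded_of_encard_isLittleO` — the same with `{i | γ i = x}.encard ≤ M x`, `M : ℝ → ℕ`
  sub-logarithmic (the vocabulary of the registered stub).

Proof of the threshold form: suppose every `γ_i` is a real zero of `F(z) := û(1/2 + iz)`. The LOWER
local Weyl law `card_near_ge_log_of_windowTrace` (level `2a`; its constants `R₀ > 0`, `c > 0`, `C`
depend on `a` only) gives, around every height `T ≥ H`, at least `c log(1+T) − C ≥ (c/2) log(1+T)`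
indices within `R₀` of `T`; the fibres there have size `≤ δ log x ≤ 2δ log(1+T)`, so the cell
`[T − R₀, T + R₀]` holds at least `c/(4δ) = αL + 1` DISTINCT real zeros of `F` (`α = 2a/log 2`,
`L = 2R₀ + 2`, `δ := c / (4(αL+1))`). Stacking the `n` disjoint cells at the heights `H + L, …, H + Ln`
gives `n(αL + 1)` distinct real zeros in `[0, H + Ln + R₀]`, against the linear Jensen count
`α(H + Ln + R₀) + β` (`exists_card_real_zeros_le_slope`) — absurd for `n` large.

The typed residual of the registered stub is the complement: families on `Z_ℝ(û)` with
`#{i | γ i = x} > δ(a) log |x|` for arbitrarily large `|x|`, at a conjugate point `a ≥ log 3 / 2`.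
-/

set_option linter.dupNamespace false

noncomputable section

open Complex Set Filter MeasureTheory
open scoped Real Topology

namespace Summit.RiemannHypothesis.RiemannHypothesis.Theorems.SpectralTraceWindowStep

open Literature.NumberTheory.LFunctions
open Summit.RiemannHypothesis.RiemannHypothesis.Theorems.WeilWindowFlowStrictUnderRH
open Summit.RiemannHypothesis.RiemannHypothesis.Theorems.WindowTraceArch.Negative

/-- **Linear Jensen count with explicit slope.** For a ground state `u` of the window `[-a, a]`
there is `β` such that for every `r ≥ 0` every finite set `Z` of real zeros `x` of `û(1/2 + i·)`
with `|x| ≤ r` has `#Z ≤ (2a / log 2) r + β` (`card_real_zeros_weilMellin_le` on the discs about a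
real `ξ` with `û(1/2 + iξ) ≠ 0`, radii `r + |ξ| + 1 < 2(r + |ξ| + 1)`). [folklore] -/
theorem exists_card_real_zeros_le_slope {a : ℝ} {u : ℝ → ℂ} (hu : IsWeilGroundState a u) :
    ∃ β : ℝ, ∀ r : ℝ, 0 ≤ r → ∀ Z : Finset ℝ,
      (∀ x ∈ Z, |x| ≤ r ∧ weilMellin u (1 / 2 + (x : ℂ) * I) = 0) →
        (Z.card : ℝ) ≤ 2 * a / Real.log 2 * r + β := by
  obtain ⟨ξ, hξ⟩ := exists_weilMellin_half_line_ne_zero hu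
  have hlog2 : 0 < Real.log 2 := Real.log_pos one_lt_two
  set K : ℝ := Real.log (max 1 (∫ t, ‖u t‖)) - Real.log ‖weilMellin u (1 / 2 + (ξ : ℂ) * I)‖
    with hK
  refine ⟨(K + a * (2 * (|ξ| + 1))) / Real.log 2, fun r hr Z hZ => ?_⟩
  have hr' : 0 < r + |ξ| + 1 := by positivity
  have hZ' : ∀ x ∈ Z, |x - ξ| ≤ r + |ξ| + 1 ∧ weilMellin u (1 / 2 + (x : ℂ) * I) = 0 := by
    intro x hx
    refine ⟨?_, (hZ x hx).2⟩
    have h1 : |x - ξ| ≤ |x| + |ξ| := abs_sub x ξ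
    linarith [(hZ x hx).1]
  have h := card_real_zeros_weilMellin_le hu hξ hr' Z hZ'
  have heq : (Real.log (max 1 (∫ t, ‖u t‖)) + a * (2 * (r + |ξ| + 1))
      - Real.log ‖weilMellin u (1 / 2 + (ξ : ℂ) * I)‖) / Real.log 2
      = 2 * a / Real.log 2 * r + (K + a * (2 * (|ξ| + 1))) / Real.log 2 := by
    rw [hK]
    field_simp
    ring
  rw [heq] at h
  exact h

/-- **Coagulation excluded below a uniform multiplicity threshold (RH-free).** For every `a > 0`
there is `δ > 0` (depending on `a` only: `δ = c / (4(αL + 1))` with `α = 2a/log 2` the Jensen slope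
and `R₀, c` the constants of the lower local Weyl law at level `2a`, `L = 2R₀ + 2`) such that: if `u`
is a ground state of the window `[-a, a]` and `γ : ι → ℝ` a real family reproducing the Weil
functional on the Weil tests of `[-2a, 2a]` with `#{i | γ i = x} ≤ δ log |x|` for all large `|x|`,
then the family is NOT contained in the real zero set of `û(1/2 + i·)`: some `û(1/2 + iγ_i) ≠ 0`.
(The cells `[T − R₀, T + R₀]`, `T = H + L, …, H + Ln`, each hold `≥ αL + 1` distinct real zeros,
against the Jensen count `exists_card_real_zeros_le_slope`.) [folklore] -/
theorem coagulation_excluded_of_mult_le_log :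
    ∀ a : ℝ, 0 < a → ∃ δ : ℝ, 0 < δ ∧
      ∀ u : ℝ → ℂ, Literature.NumberTheory.LFunctions.IsWeilGroundState a u →
        ∀ (ι : Type) (γ : ι → ℝ),
          (∃ X : ℝ, ∀ x : ℝ, X ≤ |x| → ({i : ι | γ i = x}.ncard : ℝ) ≤ δ * Real.log |x|) →
          (∀ g : ℝ → ℂ, Literature.NumberTheory.LFunctions.IsWeilTest g →
            tsupport g ⊆ Set.Icc (-(2 * a)) (2 * a) →
              HasSum (fun i => Literature.NumberTheory.LFunctions.weilMellin g (1 / 2 + (γ i : ℂ) * Complex.I))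
                (Literature.NumberTheory.LFunctions.weilFunctional g)) →
          ∃ i : ι, Literature.NumberTheory.LFunctions.weilMellin u (1 / 2 + (γ i : ℂ) * Complex.I) ≠ 0 := by
  intro a ha
  -- the lower local Weyl law at level `2a` and the constants `α, L, δ` (depending on `a` only)
  obtain ⟨R₀, c, C, hR₀, hc, hlow⟩ := card_near_ge_log_of_windowTrace (by positivity : (0 : ℝ) < 2 * a)
  have hlog2 : 0 < Real.log 2 := Real.log_pos one_lt_two
  set α : ℝ := 2 * a / Real.log 2 with hα
  have hα0 : 0 < α := by positivity
  set L : ℝ := 2 * R₀ + 2 with hL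
  have hL0 : 0 < L := by positivity
  have hαL : 0 < α * L + 1 := by positivity
  set δ : ℝ := c / (4 * (α * L + 1)) with hδ
  have hδ0 : 0 < δ := by positivity
  refine ⟨δ, hδ0, ?_⟩
  rintro u hu ι γ ⟨X, hX⟩ hγ
  classical
  by_contra hcon
  push Not at hcon
  -- the linear Jensen count (slope `α`) and the finiteness of the fibres
  obtain ⟨β, hJ⟩ := exists_card_real_zeros_le_slope hu
  have hfin : ∀ x : ℝ, {i : ι | γ i = x}.Finite := fun x =>
    (finite_abs_le_of_windowTrace (by positivity : (0 : ℝ) < 2 * a) hγ |x|).subset fun i hi => by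
      simp only [Set.mem_setOf_eq] at hi ⊢
      rw [hi]
  have hlowγ := hlow ι γ hγ
  -- the base height `H`
  have hexp : 0 < Real.exp (2 * C / c) := Real.exp_pos _
  set H : ℝ := max X 1 + R₀ + Real.exp (2 * C / c) with hH
  have hX1 : 1 ≤ max X 1 := le_max_right _ _
  have hH0 : 0 < H := by positivity
  -- one cell: `≥ αL + 1` distinct real zeros within `R₀` of every height `T ≥ H`
  have hcell : ∀ T : ℝ, H ≤ T → ∃ Z : Finset ℝ,
      (∀ x ∈ Z, weilMellin u (1 / 2 + (x : ℂ) * I) = 0 ∧ |x - T| ≤ R₀) ∧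
        α * L + 1 ≤ (Z.card : ℝ) := by
    intro T hT
    obtain ⟨s, hs, hcard⟩ := hlowγ T
    have hT0 : 0 < T := lt_of_lt_of_le hH0 hT
    rw [abs_of_pos hT0] at hcard
    set ℓ : ℝ := Real.log (1 + T) with hℓ
    have hℓpos : 0 < ℓ := Real.log_pos (by linarith)
    -- `C ≤ (c/2) ℓ`
    have hℓC : C ≤ c / 2 * ℓ := by
      have h1 : Real.exp (2 * C / c) ≤ 1 + T := by linarith
      have h2 : 2 * C / c ≤ ℓ := by
        rw [hℓ, ← Real.log_exp (2 * C / c)]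
        exact Real.log_le_log hexp h1
      rw [div_le_iff₀ hc] at h2
      linarith
    refine ⟨s.image γ, fun x hx => ?_, ?_⟩
    · obtain ⟨i, hi, rfl⟩ := Finset.mem_image.1 hx
      exact ⟨hcon i, hs i hi⟩
    · -- the fibres inside the cell have size `≤ 2δ ℓ`
      have hfib : ∀ x ∈ s.image γ, ((s.filter (fun i => γ i = x)).card : ℝ) ≤ 2 * δ * ℓ := by
        intro x hx
        obtain ⟨i, hi, rfl⟩ := Finset.mem_image.1 hx
        have hnear : |γ i - T| ≤ R₀ := hs i hi
        rw [abs_le] at hnear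
        have hx0 : 0 < γ i := by linarith [hnear.1]
        have hxX : X ≤ |γ i| := by
          rw [abs_of_pos hx0]
          linarith [le_max_left X 1, hnear.1]
        have hsub' : (↑(s.filter (fun j => γ j = γ i)) : Set ι) ⊆ {j : ι | γ j = γ i} :=
          fun j hj => (Finset.mem_filter.1 (Finset.mem_coe.1 hj)).2
        have h1 : ((s.filter (fun j => γ j = γ i)).card : ℝ) ≤ ({j : ι | γ j = γ i}.ncard : ℝ) := by
          have h := Set.ncard_le_ncard hsub' (hfin _)
          rw [Set.ncard_coe_finset] at h
          exact_mod_cast h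
        have h2 : ({j : ι | γ j = γ i}.ncard : ℝ) ≤ δ * Real.log |γ i| := hX _ hxX
        have h3 : Real.log |γ i| ≤ 2 * ℓ := by
          rw [abs_of_pos hx0]
          have h4 : Real.log (γ i) ≤ Real.log (T + R₀) :=
            Real.log_le_log hx0 (by linarith [hnear.2])
          have h6 : T + R₀ ≤ (1 + T) ^ 2 := by nlinarith
          have h5 : Real.log (T + R₀) ≤ Real.log ((1 + T) ^ 2) :=
            Real.log_le_log (by linarith) h6
          rw [Real.log_pow, Nat.cast_ofNat] at h5
          linarith
        have h4 : δ * Real.log |γ i| ≤ δ * (2 * ℓ) := mul_le_mul_of_nonneg_left h3 hδ0.le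
        linarith
      have hsum : (s.card : ℝ) ≤ ((s.image γ).card : ℝ) * (2 * δ * ℓ) := by
        have h1 : (s.card : ℝ) = ∑ x ∈ s.image γ, ((s.filter (fun i => γ i = x)).card : ℝ) := by
          rw [Finset.card_eq_sum_card_image γ s]
          push_cast
          rfl
        rw [h1]
        calc ∑ x ∈ s.image γ, ((s.filter (fun i => γ i = x)).card : ℝ)
            ≤ ∑ _x ∈ s.image γ, 2 * δ * ℓ := Finset.sum_le_sum hfib
          _ = ((s.image γ).card : ℝ) * (2 * δ * ℓ) := by rw [Finset.sum_const, nsmul_eq_mul]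
      -- combine with the lower law: `(c/2) ℓ ≤ #image · 2δ ℓ`, i.e. `αL + 1 ≤ #image`
      have hmain : c / 2 * ℓ ≤ ((s.image γ).card : ℝ) * (2 * δ * ℓ) := by linarith
      have hmain' : c / 2 ≤ ((s.image γ).card : ℝ) * (2 * δ) := by
        by_contra h7
        push Not at h7
        have : ((s.image γ).card : ℝ) * (2 * δ) * ℓ < c / 2 * ℓ := mul_lt_mul_of_pos_right h7 hℓpos
        linarith [mul_assoc (((s.image γ).card : ℝ)) (2 * δ) ℓ]
      have h5 : ((s.image γ).card : ℝ) * (2 * δ) = c / 2 * (((s.image γ).card : ℝ) / (α * L + 1)) := by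
        rw [hδ]
        field_simp
        ring
      rw [h5] at hmain'
      have h6 : 1 ≤ ((s.image γ).card : ℝ) / (α * L + 1) := by
        by_contra h7
        push Not at h7
        have : c / 2 * (((s.image γ).card : ℝ) / (α * L + 1)) < c / 2 * 1 :=
          mul_lt_mul_of_pos_left h7 (by positivity)
        linarith
      rwa [le_div_iff₀ hαL, one_mul] at h6
  -- stacking `n` disjoint cells at the heights `H + L, …, H + L n`
  have hstack : ∀ n : ℕ, ∃ Z : Finset ℝ,
      (∀ x ∈ Z, weilMellin u (1 / 2 + (x : ℂ) * I) = 0 ∧ H - R₀ ≤ x ∧ x ≤ H + L * n + R₀) ∧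
        (n : ℝ) * (α * L + 1) ≤ (Z.card : ℝ) := by
    intro n
    induction n with
    | zero => exact ⟨∅, fun x hx => absurd hx (Finset.notMem_empty x), by simp⟩
    | succ n ih =>
      obtain ⟨Z, hZ, hZc⟩ := ih
      have hn0 : (0 : ℝ) ≤ n := Nat.cast_nonneg n
      obtain ⟨Z', hZ', hZ'c⟩ := hcell (H + L * (n + 1)) (by nlinarith)
      have hdisj : Disjoint Z Z' := by
        rw [Finset.disjoint_left]
        intro x hx hx'
        have h1 := (hZ x hx).2.2
        have h2 := (hZ' x hx').2
        rw [abs_le] at h2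
        linarith [h2.1]
      refine ⟨Z ∪ Z', fun x hx => ?_, ?_⟩
      · rcases Finset.mem_union.1 hx with hx | hx
        · obtain ⟨h0, h1, h2⟩ := hZ x hx
          refine ⟨h0, h1, h2.trans ?_⟩
          push_cast
          nlinarith
        · obtain ⟨h0, h1⟩ := hZ' x hx
          rw [abs_le] at h1
          refine ⟨h0, ?_, ?_⟩
          · nlinarith [h1.1]
          · push_cast
            linarith [h1.2]
      · rw [Finset.card_union_of_disjoint hdisj]
        push_cast
        linarith
  -- Jensen on the stacked cells: `n (αL + 1) ≤ α (H + L n + R₀) + β`, so `n ≤ α (H + R₀) + β`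
  have hfinal : ∀ n : ℕ, (n : ℝ) ≤ α * (H + R₀) + β := by
    intro n
    obtain ⟨Z, hZ, hZc⟩ := hstack n
    have hr0 : 0 ≤ H + L * n + R₀ := by positivity
    have hJn := hJ (H + L * n + R₀) hr0 Z fun x hx => by
      obtain ⟨h0, h1, h2⟩ := hZ x hx
      refine ⟨?_, h0⟩
      rw [abs_of_nonneg (by linarith)]
      exact h2
    have h1 : (n : ℝ) * (α * L + 1) ≤ α * (H + L * n + R₀) + β := hZc.trans hJn
    nlinarith
  obtain ⟨n, hn⟩ := exists_nat_gt (α * (H + R₀) + β)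
  linarith [hfinal n]

/-- **Coagulation excluded for `o(log)` multiplicities, `ncard` form (RH-free).** If a real family
`γ` reproduces the Weil functional on the Weil tests of `[-2a, 2a]` and `#{i | γ i = x} = o(log |x|)`
(`∀ δ > 0, #{i | γ i = x} ≤ δ log |x|` for `|x|` large; the fibres of a window-trace family are
finite, `finite_abs_le_of_windowTrace`), then `û(1/2 + iγ_i) ≠ 0` for some `i`, for every ground
state `u` of `[-a, a]`. [folklore] -/
theorem coagulation_excluded_of_ncard_isLittleO :
    ∀ a : ℝ, 0 < a → ∀ u : ℝ → ℂ, Literature.NumberTheory.LFunctions.IsWeilGroundState a u →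
      ∀ (ι : Type) (γ : ι → ℝ),
        (∀ δ : ℝ, 0 < δ → ∃ X : ℝ, ∀ x : ℝ, X ≤ |x| →
          ({i : ι | γ i = x}.ncard : ℝ) ≤ δ * Real.log |x|) →
        (∀ g : ℝ → ℂ, Literature.NumberTheory.LFunctions.IsWeilTest g →
          tsupport g ⊆ Set.Icc (-(2 * a)) (2 * a) →
            HasSum (fun i => Literature.NumberTheory.LFunctions.weilMellin g (1 / 2 + (γ i : ℂ) * Complex.I))
              (Literature.NumberTheory.LFunctions.weilFunctional g)) →
        ∃ i : ι, Literature.NumberTheory.LFunctions.weilMellin u (1 / 2 + (γ i : ℂ) * Complex.I) ≠ 0 := by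
  intro a ha u hu ι γ hsub hγ
  obtain ⟨δ, hδ, h⟩ := coagulation_excluded_of_mult_le_log a ha
  exact h u hu ι γ (hsub δ hδ) hγ

/-- **Coagulation excluded for sub-logarithmic multiplicities (RH-free).** Let `u` be a ground
state of the window `[-a, a]` (`a > 0`) and `γ : ι → ℝ` a real family reproducing the Weil functional
on the Weil tests supported in `[-2a, 2a]`, whose fibres `{i | γ i = x}` lie in finsets of size
`≤ m(x)` with `m(x) = o(log |x|)` (`∀ δ > 0, m(x) ≤ δ log|x|` for `|x|` large). Then the family is
NOT contained in the real zero set of `û(1/2 + i·)`: some `û(1/2 + iγ_i) ≠ 0`. [folklore] -/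
theorem coagulation_excluded_of_isLittleO :
    ∀ a : ℝ, 0 < a → ∀ u : ℝ → ℂ, Literature.NumberTheory.LFunctions.IsWeilGroundState a u →
      ∀ (ι : Type) (γ : ι → ℝ) (m : ℝ → ℝ),
        (∀ x : ℝ, ∃ s : Finset ι, {i : ι | γ i = x} ⊆ ↑s ∧ (s.card : ℝ) ≤ m x) →
        (∀ δ : ℝ, 0 < δ → ∃ X : ℝ, ∀ x : ℝ, X ≤ |x| → m x ≤ δ * Real.log |x|) →
        (∀ g : ℝ → ℂ, Literature.NumberTheory.LFunctions.IsWeilTest g →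
          tsupport g ⊆ Set.Icc (-(2 * a)) (2 * a) →
            HasSum (fun i => Literature.NumberTheory.LFunctions.weilMellin g (1 / 2 + (γ i : ℂ) * Complex.I))
              (Literature.NumberTheory.LFunctions.weilFunctional g)) →
        ∃ i : ι, Literature.NumberTheory.LFunctions.weilMellin u (1 / 2 + (γ i : ℂ) * Complex.I) ≠ 0 := by
  intro a ha u hu ι γ m hmult hsub hγ
  refine coagulation_excluded_of_ncard_isLittleO a ha u hu ι γ (fun δ hδ => ?_) hγ
  obtain ⟨X, hX⟩ := hsub δ hδ
  refine ⟨X, fun x hx => ?_⟩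
  obtain ⟨s, hs, hsc⟩ := hmult x
  have h1 : ({i : ι | γ i = x}.ncard : ℝ) ≤ s.card := by
    have h := Set.ncard_le_ncard hs s.finite_toSet
    rw [Set.ncard_coe_finset] at h
    exact_mod_cast h
  exact h1.trans (hsc.trans (hX x hx))

/-- **The same, in the `encard` vocabulary of the registered edge stub.** If the multiplicities
`#{i | γ i = x} ≤ M(x)` of a level-`2a` family are `o(log |x|)` (`∀ δ > 0, M(x) ≤ δ log |x|` for
`|x|` large), the family is not contained in the real zero set of a ground-state transform
`û(1/2 + i·)`. [folklore] -/
theorem coagulation_excluded_of_encard_isLittleO :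
    ∀ a : ℝ, 0 < a → ∀ u : ℝ → ℂ, Literature.NumberTheory.LFunctions.IsWeilGroundState a u →
      ∀ (ι : Type) (γ : ι → ℝ) (M : ℝ → ℕ), (∀ x : ℝ, {i : ι | γ i = x}.encard ≤ M x) →
        (∀ δ : ℝ, 0 < δ → ∃ X : ℝ, ∀ x : ℝ, X ≤ |x| → (M x : ℝ) ≤ δ * Real.log |x|) →
        (∀ g : ℝ → ℂ, Literature.NumberTheory.LFunctions.IsWeilTest g →
          tsupport g ⊆ Set.Icc (-(2 * a)) (2 * a) →
            HasSum (fun i => Literature.NumberTheory.LFunctions.weilMellin g (1 / 2 + (γ i : ℂ) * Complex.I))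
              (Literature.NumberTheory.LFunctions.weilFunctional g)) →
        ∃ i : ι, Literature.NumberTheory.LFunctions.weilMellin u (1 / 2 + (γ i : ℂ) * Complex.I) ≠ 0 := by
  intro a ha u hu ι γ M hM hsub hγ
  refine coagulation_excluded_of_isLittleO a ha u hu ι γ (fun x => (M x : ℝ)) (fun x => ?_) hsub hγ
  have hfin : {i : ι | γ i = x}.Finite := Set.finite_of_encard_le_coe (hM x)
  refine ⟨hfin.toFinset, by simp, ?_⟩
  have h1 := hM x
  rw [hfin.encard_eq_coe_toFinset_card] at h1
  exact_mod_cast h1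

end Summit.RiemannHypothesis.RiemannHypothesis.Theorems.SpectralTraceWindowStep

end
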